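/-
Copyright: statement-level skeleton of a published paper (lit-balaban cell, Phase-2 proof seat p25, gen 18). No proof
claims beyond what the kernel checks below.
-/
import Literature.MathematicalPhysics.QuantumFieldTheory.BalabanImbrieJaffe1984to88.BIJ88WalkExpansion311

/-!
# `BalabanImbrieJaffe1984to88.BIJ88WalkWeights312` — T. Bałaban, J. Imbrie, A. Jaffe, *Effective action and cluster
properties of the abelian Higgs model*, Commun. Math. Phys. **114** (1988) 257–315 [BalabanImbrieJaffe1988], §5.14
p. 312 [PDF 56], verbatim: *"The main source of concern in estimating G_k(X_{r′}) is that we only have bounds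
|F_{k,loc}(X_{σ₁})| ≤ c(L^kε)^{−m(c)}e^{−m′(c)}, coming from our estimates on perturbation expansions of observables …
By performing sufficiently many integrations by parts, we have arranged for enough small factors to beat these large
factors in the remainder terms"* — **THE WEIGHT OF A TERM, COMPONENT BY COMPONENT** for the expansion with the
covariance split (`BIJ88WalkExpansion311.expand`, p25 gen 18).  Three pieces of bookkeeping that turn the product of
contraction weights of a term into a product over its blocks and remainder components — the currency of a polymer
activity: (1) LABELS ARE DISJOINT (every observable lies in exactly one component), (2) THE NUMBER OF CONTRACTIONS
RECORDED IN A COMPONENT IS AT MOST ITS LEG BUDGET (legs of its observables + legs of its vertices: every contraction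
consumes a pending leg) — so the LARGE bracket factors are at most `B^{#legs}` per observable and per vertex, (3) THE
WEIGHT INVARIANT: `|a| · Π‖χ′-directions‖` of an outcome is at most the product, over the pieces and vertices it
recorded, of the bracket bounds `B p` and coupling bounds `cV m`; hence for a term
`|coef_t| · Π_{z ∈ dirs_t}‖z‖ ≤ Π_{X ∈ blocks ∪ remainder components} wt(X)`, `wt(X) = Π_{p ∈ X.pcs} B p · Π_{m ∈ X.vxs} cV m`.

statement-level skeleton of published theorems with citation tags; proofs where landed; nothing here is a claim
about the Yang–Mills mass gap

PDF held: `paper:balaban1988-cmp114-bij-abelian-higgs-effective-action` (journal page = PDF page + 256); p. 311–312 =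
PDF 55–56 (`p0055.txt` L23–38, `p0056.txt` L1–25 re-read this session, 2026-08-22).

CITATION HEADER (lean-in-tree rule).  lit-balaban cell (HOME `run/shared/lean/pub/lit-balaban/`), Phase 2, seat p25
gen 18; row **C2.Claim@312** of `HOME/lit-balaban-r16/ROWS-C2-part2.md` (owner r16, referee ref-5; head
`BIJ88Sect5StatementsPart4.Ineq312` untouched).  USED BY NAME, nothing restated: `BIJ88WalkRun311.{WGrp, WOut, run,
pristine, WGrp.absorb}`, `BIJ88WalkRunEnv311.{run_ind', run_rest_subset, run_done_le}`, `BIJ88WalkExpansion311.{WTerm,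
oact, expand, expand_of_nonempty, expand_of_not_nonempty}` (this seat and generation), `BIJ88LabelledRun311.mem_mbind`.

## What is proved (0 `sorry`, standard axioms, no new `Prop` facts; definitions with bodies: `LabDisj`, `budget`,
`Tidy`, `wt`, `tsize`)

* §1 **`LabDisj`** (the labels of the component, of the set-aside components and the untouched observables are
  pairwise disjoint) and **`run_labDisj`** (preserved along a run), `labDisj_pristine`.
* §2 `budget` (legs of the observables + legs of the vertices of a component), **`Tidy`** (`#pcs + #pend ≤ budget`),
  `tidy_pristine`, **`run_tidy`** (preserved: every contraction consumes a pending leg), hence `card_pcs_le_budget`.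
* §3 `wt` (the product of the bracket bounds of the recorded pieces and the coupling bounds of the recorded vertices),
  `tsize` (`|a|·Π‖directions‖` of an outcome), **`run_weight`** (THE WEIGHT INVARIANT along a run, legs in a
  direction set `Dir` on which the brackets of the piece `p` are bounded by `B p`, `‖Cov p u‖ ≤ B p`, `|c m| ≤ cV m`),
  **`expand_weight`** / `expand_weight_init` (for a term: `|coef|·Π‖dirs‖ ≤ Π_{blocks} wt · Π_{remainder components} wt`).
HONEST SCOPE: (a) bookkeeping inequalities only: `B p`, `cV m` are free nonnegative data (print's LARGE factors for the
local piece, SMALL for random-walk pieces and vertices — not quantified here); (b) the `χ′`-directions enter through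
their sup norms (the analytic factor `∫Π Φ·(Π∂_{z/‖z‖})χe^{−V}` is not estimated here); (c) the number of terms is not
counted here; (d) contraction-graph components, fixed order of events.  NOT summit progress; NOT continuum; NOT Clay.
Imports `BIJ88WalkExpansion311` only; modifies nothing.
-/

noncomputable section

namespace Literature.MathematicalPhysics.QuantumFieldTheory.BalabanImbrieJaffe1984to88.BIJ88WalkWeights312

open Classical Matrix Finset
open scoped BigOperators
open BIJ88LabelledRun311 (mbind mem_mbind)
open BIJ88WalkRun311 BIJ88WalkRunEnv311 BIJ88WalkExpansion311

variable {S : Type} [Fintype S] {ι : Type} [Fintype ι] {κ : Type} [LinearOrder κ] {P : Type} [Fintype P]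

section Run

variable {Cov : P → Matrix S S ℝ} {trig : P → Bool} {f : S → ℝ} {c : ι → ℝ} {legs : ι → List (S → ℝ)}
  {obs : κ → List (S → ℝ)} {M : ℕ}

/-! ## §1  Labels are disjoint -/

/-- **Every observable lies in exactly one place**: the labels of the running component, of each complete component
set aside, and the untouched observables are pairwise disjoint. [cite: BalabanImbrieJaffe1988, §5.14 p.311] -/
def LabDisj (g : WGrp S κ ι P) (rest : Finset κ) (done : Multiset (WGrp S κ ι P)) : Prop :=
  Disjoint g.lab rest ∧ (∀ h ∈ done, Disjoint g.lab h.lab ∧ Disjoint h.lab rest)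
    ∧ ∀ h₁ ∈ done, ∀ h₂ ∈ done.erase h₁, Disjoint h₁.lab h₂.lab

omit [Fintype S] [Fintype ι] [Fintype P] in
/-- The initial state of a run in the expansion: a pristine observable taken out of the environment, complete
components with labels disjoint from it, from each other and from the environment. [cite: BalabanImbrieJaffe1988, §5.14 p.311] -/
theorem labDisj_pristine {j : κ} {rest : Finset κ} {done : Multiset (WGrp S κ ι P)}
    (hd : ∀ h ∈ done, Disjoint h.lab rest) (hdd : ∀ h₁ ∈ done, ∀ h₂ ∈ done.erase h₁, Disjoint h₁.lab h₂.lab)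
    (hj : j ∈ rest) : LabDisj (pristine (ι := ι) (P := P) obs j) (rest.erase j) done := by
  refine ⟨?_, fun h hh => ⟨?_, ?_⟩, hdd⟩
  · simp only [pristine, Finset.disjoint_singleton_left, Finset.mem_erase, ne_eq, not_true_eq_false, false_and,
      not_false_eq_true]
  · simp only [pristine, Finset.disjoint_singleton_left]
    exact fun hj' => Finset.disjoint_right.1 (hd h hh) hj hj'
  · exact Disjoint.mono_right (Finset.erase_subset _ _) (hd h hh)

/-- **Labels stay disjoint along a run.** [cite: BalabanImbrieJaffe1988, §5.14 p.311] -/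
theorem run_labDisj (g : WGrp S κ ι P) (rest : Finset κ) (done : Multiset (WGrp S κ ι P)) :
    ∀ o ∈ run Cov trig f c legs obs M g rest done, LabDisj g rest done → LabDisj o.g o.rest o.done := by
  refine run_ind' (Q := fun g rest done o => LabDisj g rest done → LabDisj o.g o.rest o.done)
    (fun _ _ _ _ h => h) ?_ ?_ ?_ ?_ ?_ ?_ g rest done
  · intro g rest done u L p _ _ i o _ IH h; exact IH h
  · intro g rest done u L p _ _ j hj i o _ IH h
    refine IH ⟨?_, fun h' hh' => ⟨?_, ?_⟩, h.2.2⟩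
    · rw [Finset.disjoint_union_left]
      exact ⟨Disjoint.mono_right (Finset.erase_subset _ _) h.1, Finset.disjoint_singleton_left.2 (Finset.notMem_erase _ _)⟩
    · rw [Finset.disjoint_union_left]
      exact ⟨(h.2.1 h' hh').1, Finset.disjoint_singleton_left.2 fun hj' => Finset.disjoint_right.1 (h.2.1 h' hh').2 hj hj'⟩
    · exact Disjoint.mono_right (Finset.erase_subset _ _) (h.2.1 h' hh').2
  · intro g rest done u L p _ _ h hh i _ o _ IH hL
    refine IH ⟨?_, fun h' hh' => ⟨?_, ?_⟩, fun h₁ hh₁ h₂ hh₂ => ?_⟩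
    · simp only [WGrp.absorb, Finset.disjoint_union_left]
      exact ⟨hL.1, (hL.2.1 h hh).2⟩
    · simp only [WGrp.absorb, Finset.disjoint_union_left]
      exact ⟨(hL.2.1 h' (Multiset.mem_of_le (Multiset.erase_le _ _) hh')).1, hL.2.2 h hh h' hh'⟩
    · exact (hL.2.1 h' (Multiset.mem_of_le (Multiset.erase_le _ _) hh')).2
    · have hh₁' : h₁ ∈ done := Multiset.mem_of_le (Multiset.erase_le _ _) hh₁
      have hh₂' : h₂ ∈ done.erase h₁ := Multiset.mem_of_le (by
        rw [Multiset.erase_comm]; exact Multiset.erase_le _ _) hh₂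
      exact hL.2.2 h₁ hh₁' h₂ hh₂'
  · intro g rest done u L p _ _ o _ IH h; exact IH h
  · intro g rest done u L p _ _ o _ IH h; exact IH h
  · intro g rest done u L p _ _ m j o _ IH h; exact IH h

/-! ## §2  The number of contractions recorded in a component is at most its leg budget -/

/-- **The leg budget of a component**: the legs of its observables plus the legs of the vertices it differentiated
down. [cite: BalabanImbrieJaffe1988, §5.14 p.311–312] -/
def budget (obs : κ → List (S → ℝ)) (legs : ι → List (S → ℝ)) (g : WGrp S κ ι P) : ℕ :=
  ∑ j ∈ g.lab, (obs j).length + (g.vxs.map fun m => (legs m).length).sum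

/-- **Every contraction consumes a pending leg**: the pieces recorded plus the pending legs number at most the leg
budget. [cite: BalabanImbrieJaffe1988, §5.14 p.311–312] -/
def Tidy (obs : κ → List (S → ℝ)) (legs : ι → List (S → ℝ)) (g : WGrp S κ ι P) : Prop :=
  Multiset.card g.pcs + g.pend.length ≤ budget obs legs g

omit [Fintype S] [Fintype ι] [LinearOrder κ] [Fintype P] in
/-- A pristine observable is tidy. [cite: BalabanImbrieJaffe1988, §5.14 p.311] -/
theorem tidy_pristine (j : κ) : Tidy (ι := ι) (P := P) obs legs (pristine obs j) := by
  simp [Tidy, budget, pristine]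

/-- **Tidiness is preserved along a run** (given disjoint labels): (1) a pairing consumes two legs, (2) a pristine
observable brings its legs and its budget, (3) an absorbed component brings its legs, pieces and budget, (4)/(5) the
source and `χ′` consume one leg, (6) a vertex brings its other legs and its budget.
[cite: BalabanImbrieJaffe1988, §5.14 p.311–312] -/
theorem run_tidy (g : WGrp S κ ι P) (rest : Finset κ) (done : Multiset (WGrp S κ ι P)) :
    ∀ o ∈ run Cov trig f c legs obs M g rest done, LabDisj g rest done → Tidy obs legs g →
      (∀ h ∈ done, Tidy obs legs h) → Tidy obs legs o.g ∧ ∀ h ∈ o.done, Tidy obs legs h := by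
  refine run_ind' (Q := fun g rest done o => LabDisj g rest done → Tidy obs legs g →
      (∀ h ∈ done, Tidy obs legs h) → Tidy obs legs o.g ∧ ∀ h ∈ o.done, Tidy obs legs h)
    (fun _ _ _ _ _ hg hd => ⟨hg, hd⟩) ?_ ?_ ?_ ?_ ?_ ?_ g rest done
  · intro g rest done u L p _ hp i o ho IH hL hg hd
    refine IH hL ?_ hd
    have h1 := List.length_eraseIdx_le L i
    simp only [Tidy, budget, hp, List.length_cons, Multiset.card_cons] at hg ⊢
    omega
  · intro g rest done u L p _ hp j hj i o _ IH hL hg hd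
    have hjl : j ∉ g.lab := fun h => Finset.disjoint_left.1 hL.1 h hj
    refine IH ?_ ?_ hd
    · refine ⟨?_, fun h' hh' => ⟨?_, ?_⟩, hL.2.2⟩
      · rw [Finset.disjoint_union_left]
        exact ⟨Disjoint.mono_right (Finset.erase_subset _ _) hL.1,
          Finset.disjoint_singleton_left.2 (Finset.notMem_erase _ _)⟩
      · rw [Finset.disjoint_union_left]
        exact ⟨(hL.2.1 h' hh').1,
          Finset.disjoint_singleton_left.2 fun hj' => Finset.disjoint_right.1 (hL.2.1 h' hh').2 hj hj'⟩
      · exact Disjoint.mono_right (Finset.erase_subset _ _) (hL.2.1 h' hh').2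
    · have h1 := List.length_eraseIdx_le (obs j) i
      have h2 : ∑ k ∈ g.lab ∪ {j}, (obs k).length = ∑ k ∈ g.lab, (obs k).length + (obs j).length := by
        rw [Finset.sum_union (Finset.disjoint_singleton_right.2 hjl), Finset.sum_singleton]
      simp only [Tidy, budget, hp, List.length_cons, List.length_append, Multiset.card_cons, h2] at hg ⊢
      omega
  · intro g rest done u L p _ hp h hh i hi o _ IH hL hg hd
    have hdisj : Disjoint g.lab h.lab := (hL.2.1 h hh).1
    refine IH ?_ ?_ (fun h' hh' => hd h' (Multiset.mem_of_le (Multiset.erase_le _ _) hh'))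
    · refine ⟨?_, fun h' hh' => ⟨?_, ?_⟩, fun h₁ hh₁ h₂ hh₂ => ?_⟩
      · simp only [WGrp.absorb, Finset.disjoint_union_left]
        exact ⟨hL.1, (hL.2.1 h hh).2⟩
      · simp only [WGrp.absorb, Finset.disjoint_union_left]
        exact ⟨(hL.2.1 h' (Multiset.mem_of_le (Multiset.erase_le _ _) hh')).1, hL.2.2 h hh h' hh'⟩
      · exact (hL.2.1 h' (Multiset.mem_of_le (Multiset.erase_le _ _) hh')).2
      · have hh₁' : h₁ ∈ done := Multiset.mem_of_le (Multiset.erase_le _ _) hh₁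
        have hh₂' : h₂ ∈ done.erase h₁ := Multiset.mem_of_le (by
          rw [Multiset.erase_comm]; exact Multiset.erase_le _ _) hh₂
        exact hL.2.2 h₁ hh₁' h₂ hh₂'
    · have h1 := List.length_eraseIdx_le h.pend i
      have hh' := hd h hh
      have h2 : ∑ k ∈ g.lab ∪ h.lab, (obs k).length
          = ∑ k ∈ g.lab, (obs k).length + ∑ k ∈ h.lab, (obs k).length := Finset.sum_union hdisj
      simp only [Tidy, budget, hp, List.length_cons, WGrp.absorb, List.length_append, Multiset.card_cons,
        Multiset.card_add, Multiset.map_add, Multiset.sum_add, h2] at hg hh' ⊢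
      omega
  · intro g rest done u L p _ hp o _ IH hL hg hd
    refine IH hL ?_ hd
    simp only [Tidy, budget, hp, List.length_cons, Multiset.card_cons] at hg ⊢
    omega
  · intro g rest done u L p _ hp o _ IH hL hg hd
    refine IH hL ?_ hd
    simp only [Tidy, budget, hp, List.length_cons, Multiset.card_cons] at hg ⊢
    omega
  · intro g rest done u L p _ hp m j o _ IH hL hg hd
    refine IH hL ?_ hd
    have h1 := List.length_eraseIdx_le (legs m) j
    simp only [Tidy, budget, hp, List.length_cons, List.length_append, Multiset.card_cons, Multiset.map_cons,
      Multiset.sum_cons] at hg ⊢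
    omega

omit [Fintype S] [Fintype ι] [LinearOrder κ] [Fintype P] in
/-- **At most `budget` contractions are recorded in a tidy component** — the exponent of the large bracket factors.
[cite: BalabanImbrieJaffe1988, §5.14 p.312] -/
theorem card_pcs_le_budget {g : WGrp S κ ι P} (h : Tidy obs legs g) : Multiset.card g.pcs ≤ budget obs legs g :=
  le_trans (Nat.le_add_right _ _) h

/-! ## §3  The weight invariant -/

/-- **The weight of a component**: the product of the bracket bounds of the pieces it recorded and of the coupling
bounds of the vertices it recorded. [cite: BalabanImbrieJaffe1988, §5.14 p.312] -/
def wt (B : P → ℝ) (cV : ι → ℝ) (g : WGrp S κ ι P) : ℝ := (g.pcs.map B).prod * (g.vxs.map cV).prod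

/-- **The size of an outcome**: `|a| · Π_{z ∈ D}‖z‖` (the `χ′`-directions enter through their norms).
[cite: BalabanImbrieJaffe1988, §5.14 p.312] -/
def tsize (o : WOut S κ ι P) : ℝ := |o.a| * (o.D.map fun z => ‖z‖).prod

omit [Fintype S] [Fintype ι] [LinearOrder κ] [Fintype P] in
/-- Weights are nonnegative for nonnegative bounds (bookkeeping). [folklore] -/
private theorem wt_nonneg {B : P → ℝ} {cV : ι → ℝ} (hB : ∀ p, 0 ≤ B p) (hcV : ∀ m, 0 ≤ cV m) (g : WGrp S κ ι P) :
    0 ≤ wt B cV g :=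
  mul_nonneg (Multiset.prod_nonneg fun x hx => by
      obtain ⟨p, -, rfl⟩ := Multiset.mem_map.1 hx; exact hB p)
    (Multiset.prod_nonneg fun x hx => by obtain ⟨m, -, rfl⟩ := Multiset.mem_map.1 hx; exact hcV m)

omit [Fintype S] [Fintype ι] [LinearOrder κ] [Fintype P] in
/-- Products of weights are nonnegative (bookkeeping). [folklore] -/
private theorem prod_wt_nonneg {B : P → ℝ} {cV : ι → ℝ} (hB : ∀ p, 0 ≤ B p) (hcV : ∀ m, 0 ≤ cV m)
    (done : Multiset (WGrp S κ ι P)) : 0 ≤ (done.map (wt B cV)).prod :=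
  Multiset.prod_nonneg fun x hx => by obtain ⟨h, -, rfl⟩ := Multiset.mem_map.1 hx; exact wt_nonneg hB hcV h

omit [Fintype ι] [LinearOrder κ] [Fintype P] in
/-- Sizes are nonnegative (bookkeeping). [folklore] -/
private theorem tsize_nonneg (o : WOut S κ ι P) : 0 ≤ tsize o :=
  mul_nonneg (abs_nonneg _) (List.prod_nonneg fun x hx => by
    obtain ⟨z, -, rfl⟩ := List.mem_map.1 hx; exact norm_nonneg _)

omit [Fintype S] [Fintype ι] [LinearOrder κ] [Fintype P] in
/-- Recording a piece multiplies the weight by its bound (bookkeeping). [folklore] -/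
private theorem wt_rec (B : P → ℝ) (cV : ι → ℝ) (g : WGrp S κ ι P) (L : List (S → ℝ)) (n nw : ℕ) (p : P) :
    wt B cV (⟨L, n, g.vxs, g.lab, p ::ₘ g.pcs, nw⟩ : WGrp S κ ι P) = B p * wt B cV g := by
  simp only [wt, Multiset.map_cons, Multiset.prod_cons, mul_assoc]

omit [Fintype S] [Fintype ι] [LinearOrder κ] [Fintype P] in
/-- Recording a piece and a label (bookkeeping). [folklore] -/
private theorem wt_lab (B : P → ℝ) (cV : ι → ℝ) (g : WGrp S κ ι P) (L : List (S → ℝ)) (n nw : ℕ) (lab : Finset κ)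
    (p : P) : wt B cV (⟨L, n, g.vxs, lab, p ::ₘ g.pcs, nw⟩ : WGrp S κ ι P) = B p * wt B cV g := by
  simp only [wt, Multiset.map_cons, Multiset.prod_cons, mul_assoc]

omit [Fintype S] [Fintype ι] [LinearOrder κ] [Fintype P] in
/-- Recording a piece and a vertex (bookkeeping). [folklore] -/
private theorem wt_vx (B : P → ℝ) (cV : ι → ℝ) (g : WGrp S κ ι P) (L : List (S → ℝ)) (n nw : ℕ) (m : ι) (p : P) :
    wt B cV (⟨L, n, m ::ₘ g.vxs, g.lab, p ::ₘ g.pcs, nw⟩ : WGrp S κ ι P) = B p * cV m * wt B cV g := by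
  simp only [wt, Multiset.map_cons, Multiset.prod_cons]; ring

omit [Fintype S] [Fintype ι] [Fintype P] in
/-- Absorbing a component multiplies the weights (bookkeeping). [folklore] -/
private theorem wt_absorb (B : P → ℝ) (cV : ι → ℝ) (L : List (S → ℝ)) (g h : WGrp S κ ι P) (i : ℕ) (p : P) :
    wt B cV (WGrp.absorb trig L g h i p) = B p * wt B cV g * wt B cV h := by
  simp only [wt, WGrp.absorb, Multiset.map_cons, Multiset.prod_cons, Multiset.map_add, Multiset.prod_add]; ring

omit [Fintype S] in
/-- A positional leg is a leg, or the default `0` (bookkeeping). [folklore] -/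
private theorem getD_mem_or (L : List (S → ℝ)) (i : ℕ) : L.getD i 0 ∈ L ∨ L.getD i 0 = 0 := by
  by_cases hi : i < L.length
  · rw [List.getD_eq_getElem L 0 hi]; exact Or.inl (List.getElem_mem hi)
  · exact Or.inr (List.getD_eq_default L 0 (not_lt.1 hi))

omit [Fintype S] [Fintype ι] [LinearOrder κ] [Fintype P] in
/-- One multiplicative step of the invariant (bookkeeping): `b ≤ Bp`, `T·(Bp·W) ≤ E` ⇒ `b·T·W ≤ E` for `T, W ≥ 0`.
[folklore] -/
private theorem step {b Bp T W E : ℝ} (hb : b ≤ Bp) (hT : 0 ≤ T) (hW : 0 ≤ W)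
    (h : T * (Bp * W) ≤ E) : b * T * W ≤ E :=
  le_trans (by nlinarith [mul_nonneg hT hW]) h

omit [Fintype ι] [LinearOrder κ] [Fintype P] in
/-- Size of a scaled outcome (bookkeeping). [folklore] -/
private theorem tsize_scale (p : P) (b : ℝ) (o : WOut S κ ι P) : tsize (o.scale p b) = |b| * tsize o := by
  simp only [tsize, WOut.scale_a, WOut.scale_D, abs_mul, mul_assoc]

omit [Fintype ι] [LinearOrder κ] [Fintype P] in
/-- Size of an outcome with one more direction (bookkeeping). [folklore] -/
private theorem tsize_push (p : P) (z : S → ℝ) (o : WOut S κ ι P) : tsize (o.push p z) = ‖z‖ * tsize o := by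
  simp only [tsize, WOut.push_a, WOut.push_D, List.map_cons, List.prod_cons]; ring

omit [Fintype ι] [LinearOrder κ] [Fintype P] in
/-- Size of a scaled outcome with a vertex recorded (bookkeeping). [folklore] -/
private theorem tsize_scale_bump (p : P) (b : ℝ) (o : WOut S κ ι P) : tsize (o.scale p b).bump = |b| * tsize o := by
  simp only [tsize, WOut.bump_a, WOut.bump_D, WOut.scale_a, WOut.scale_D, abs_mul, mul_assoc]

/-- **Direction bookkeeping**: if the legs of every observable and of every vertex lie in `Dir`, so do the pending
legs of every outcome's component (from a component and set-aside components with legs in `Dir`).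
[cite: BalabanImbrieJaffe1988, §5.14 p.311] -/
theorem run_pend_dir {Dir : Set (S → ℝ)} (hobs : ∀ j, ∀ w ∈ obs j, w ∈ Dir) (hlegs : ∀ m, ∀ w ∈ legs m, w ∈ Dir)
    (g : WGrp S κ ι P) (rest : Finset κ) (done : Multiset (WGrp S κ ι P)) :
    ∀ o ∈ run Cov trig f c legs obs M g rest done, (∀ w ∈ g.pend, w ∈ Dir) → (∀ h ∈ done, ∀ w ∈ h.pend, w ∈ Dir) →
      ∀ w ∈ o.g.pend, w ∈ Dir := by
  refine run_ind' (Q := fun g _ done o => (∀ w ∈ g.pend, w ∈ Dir) → (∀ h ∈ done, ∀ w ∈ h.pend, w ∈ Dir) →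
      ∀ w ∈ o.g.pend, w ∈ Dir) (fun _ _ _ _ hg _ => hg) ?_ ?_ ?_ ?_ ?_ ?_ g rest done
  · intro g rest done u L p _ hp i o _ IH hg hd
    exact IH (fun w hw => hg w (by rw [hp]; exact List.mem_cons_of_mem _ (List.mem_of_mem_eraseIdx hw))) hd
  · intro g rest done u L p _ hp j _ i o _ IH hg hd
    refine IH (fun w hw => ?_) hd
    rcases List.mem_append.1 hw with hw | hw
    · exact hg w (by rw [hp]; exact List.mem_cons_of_mem _ hw)
    · exact hobs j w (List.mem_of_mem_eraseIdx hw)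
  · intro g rest done u L p _ hp h hh i _ o _ IH hg hd
    refine IH (fun w hw => ?_) (fun h' hh' => hd h' (Multiset.mem_of_le (Multiset.erase_le _ _) hh'))
    simp only [WGrp.absorb, List.mem_append] at hw
    rcases hw with hw | hw
    · exact hg w (by rw [hp]; exact List.mem_cons_of_mem _ hw)
    · exact hd h hh w (List.mem_of_mem_eraseIdx hw)
  · intro g rest done u L p _ hp o _ IH hg hd
    exact IH (fun w hw => hg w (by rw [hp]; exact List.mem_cons_of_mem _ hw)) hd
  · intro g rest done u L p _ hp o _ IH hg hd
    exact IH (fun w hw => hg w (by rw [hp]; exact List.mem_cons_of_mem _ hw)) hd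
  · intro g rest done u L p _ hp m j o _ IH hg hd
    refine IH (fun w hw => ?_) hd
    rcases List.mem_append.1 hw with hw | hw
    · exact hg w (by rw [hp]; exact List.mem_cons_of_mem _ hw)
    · exact hlegs m w (List.mem_of_mem_eraseIdx hw)

/-- **THE WEIGHT INVARIANT ALONG A RUN** (p. 312: large factors per contraction, small factors per vertex and per
random-walk piece, booked where they occur): legs in a direction set `Dir` (observables' and vertices' legs in `Dir`),
brackets of the piece `p` between legs of `Dir` and to the source bounded by `B p ≥ 0`, `‖Cov p u‖ ≤ B p` on `Dir`,
couplings `|c m| ≤ cV m`.  Then for every outcome `o` of `run g rest done`: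
`tsize o · wt g · Π_{h ∈ done} wt h ≤ wt o.g · Π_{h ∈ o.done} wt h`. [cite: BalabanImbrieJaffe1988, §5.14 p.312] -/
theorem run_weight {Dir : Set (S → ℝ)} {B : P → ℝ} {cV : ι → ℝ} (hB0 : ∀ p, 0 ≤ B p) (hcV0 : ∀ m, 0 ≤ cV m)
    (hB : ∀ p, ∀ u ∈ Dir, ∀ w ∈ Dir, |(Cov p *ᵥ u) ⬝ᵥ w| ≤ B p) (hBf : ∀ p, ∀ u ∈ Dir, |(Cov p *ᵥ u) ⬝ᵥ f| ≤ B p)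
    (hBz : ∀ p, ∀ u ∈ Dir, ‖Cov p *ᵥ u‖ ≤ B p) (hcV : ∀ m, |c m| ≤ cV m)
    (hobs : ∀ j, ∀ w ∈ obs j, w ∈ Dir) (hlegs : ∀ m, ∀ w ∈ legs m, w ∈ Dir)
    (g : WGrp S κ ι P) (rest : Finset κ) (done : Multiset (WGrp S κ ι P)) :
    ∀ o ∈ run Cov trig f c legs obs M g rest done, (∀ w ∈ g.pend, w ∈ Dir) → (∀ h ∈ done, ∀ w ∈ h.pend, w ∈ Dir) →
      tsize o * (wt B cV g * (done.map (wt B cV)).prod) ≤ wt B cV o.g * (o.done.map (wt B cV)).prod := by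
  have hgetD : ∀ p, ∀ u ∈ Dir, ∀ L : List (S → ℝ), (∀ w ∈ L, w ∈ Dir) → ∀ i, |(Cov p *ᵥ u) ⬝ᵥ L.getD i 0| ≤ B p :=
    fun p u hu L hL i => by
      rcases getD_mem_or L i with h | h
      · exact hB p u hu _ (hL _ h)
      · rw [h, dotProduct_zero, abs_zero]; exact hB0 p
  have hW : ∀ (g : WGrp S κ ι P) (done : Multiset (WGrp S κ ι P)), 0 ≤ wt B cV g * (done.map (wt B cV)).prod :=
    fun g done => mul_nonneg (wt_nonneg hB0 hcV0 _) (prod_wt_nonneg hB0 hcV0 _)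
  refine run_ind' (Q := fun g _ done o => (∀ w ∈ g.pend, w ∈ Dir) → (∀ h ∈ done, ∀ w ∈ h.pend, w ∈ Dir) →
      tsize o * (wt B cV g * (done.map (wt B cV)).prod) ≤ wt B cV o.g * (o.done.map (wt B cV)).prod)
    (fun g _ done _ _ _ => by simp [tsize]) ?_ ?_ ?_ ?_ ?_ ?_ g rest done
  · intro g rest done u L p _ hp i o _ IH hg hd
    have hu : u ∈ Dir := hg u (by rw [hp]; exact List.mem_cons_self)
    have hL : ∀ w ∈ L, w ∈ Dir := fun w hw => hg w (by rw [hp]; exact List.mem_cons_of_mem _ hw)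
    have h := IH (fun w hw => hL w (List.mem_of_mem_eraseIdx hw)) hd
    rw [wt_rec, mul_assoc (B p)] at h
    simp only [WOut.scale_g, WOut.scale_done, tsize_scale]
    exact step (hgetD p u hu L hL i) (tsize_nonneg o) (hW _ _) h
  · intro g rest done u L p _ hp j _ i o _ IH hg hd
    have hu : u ∈ Dir := hg u (by rw [hp]; exact List.mem_cons_self)
    have hL : ∀ w ∈ L, w ∈ Dir := fun w hw => hg w (by rw [hp]; exact List.mem_cons_of_mem _ hw)
    have h := IH (fun w hw => by
      rcases List.mem_append.1 hw with hw | hw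
      · exact hL w hw
      · exact hobs j w (List.mem_of_mem_eraseIdx hw)) hd
    rw [wt_lab, mul_assoc (B p)] at h
    simp only [WOut.scale_g, WOut.scale_done, tsize_scale]
    exact step (hgetD p u hu _ (hobs j) i) (tsize_nonneg o) (hW _ _) h
  · intro g rest done u L p _ hp h hh i _ o _ IH hg hd
    have hu : u ∈ Dir := hg u (by rw [hp]; exact List.mem_cons_self)
    have hL : ∀ w ∈ L, w ∈ Dir := fun w hw => hg w (by rw [hp]; exact List.mem_cons_of_mem _ hw)
    have h' := IH (fun w hw => by
      simp only [WGrp.absorb, List.mem_append] at hw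
      rcases hw with hw | hw
      · exact hL w hw
      · exact hd h hh w (List.mem_of_mem_eraseIdx hw))
      (fun h' hh' => hd h' (Multiset.mem_of_le (Multiset.erase_le _ _) hh'))
    rw [wt_absorb, mul_assoc (B p * wt B cV g), mul_assoc (B p)] at h'
    have hprod : (done.map (wt B cV)).prod = wt B cV h * ((done.erase h).map (wt B cV)).prod := by
      conv_lhs => rw [← Multiset.cons_erase hh]
      rw [Multiset.map_cons, Multiset.prod_cons]
    simp only [WOut.scale_g, WOut.scale_done, tsize_scale]
    rw [hprod]
    exact step (hgetD p u hu _ (hd h hh) i) (tsize_nonneg o)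
      (mul_nonneg (wt_nonneg hB0 hcV0 _) (mul_nonneg (wt_nonneg hB0 hcV0 _) (prod_wt_nonneg hB0 hcV0 _))) h'
  · intro g rest done u L p _ hp o _ IH hg hd
    have hu : u ∈ Dir := hg u (by rw [hp]; exact List.mem_cons_self)
    have hL : ∀ w ∈ L, w ∈ Dir := fun w hw => hg w (by rw [hp]; exact List.mem_cons_of_mem _ hw)
    have h := IH hL hd
    rw [wt_rec, mul_assoc (B p)] at h
    simp only [WOut.scale_g, WOut.scale_done, tsize_scale]
    exact step (hBf p u hu) (tsize_nonneg o) (hW _ _) h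
  · intro g rest done u L p _ hp o _ IH hg hd
    have hu : u ∈ Dir := hg u (by rw [hp]; exact List.mem_cons_self)
    have hL : ∀ w ∈ L, w ∈ Dir := fun w hw => hg w (by rw [hp]; exact List.mem_cons_of_mem _ hw)
    have h := IH hL hd
    rw [wt_rec, mul_assoc (B p)] at h
    simp only [WOut.push_g, WOut.push_done, tsize_push]
    exact step (hBz p u hu) (tsize_nonneg o) (hW _ _) h
  · intro g rest done u L p _ hp m j o _ IH hg hd
    have hu : u ∈ Dir := hg u (by rw [hp]; exact List.mem_cons_self)
    have hL : ∀ w ∈ L, w ∈ Dir := fun w hw => hg w (by rw [hp]; exact List.mem_cons_of_mem _ hw)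
    have h := IH (fun w hw => by
      rcases List.mem_append.1 hw with hw | hw
      · exact hL w hw
      · exact hlegs m w (List.mem_of_mem_eraseIdx hw)) hd
    rw [wt_vx, mul_assoc (B p * cV m)] at h
    simp only [WOut.bump_g, WOut.bump_done, WOut.scale_g, WOut.scale_done, tsize_scale_bump]
    have hb : |(-(c m * ((Cov p *ᵥ u) ⬝ᵥ (legs m).getD j 0)))| ≤ B p * cV m := by
      rw [abs_neg, abs_mul, mul_comm (B p)]
      exact mul_le_mul (hcV m) (hgetD p u hu _ (hlegs m) j) (abs_nonneg _) (hcV0 m)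
    exact step hb (tsize_nonneg o) (hW _ _) h

end Run

/-! ### The weight of a term -/

section Expand

variable {Cov : P → Matrix S S ℝ} {trig : P → Bool} {f : S → ℝ} {c : ι → ℝ} {legs : ι → List (S → ℝ)}
  {obs : κ → List (S → ℝ)} {M : ℕ}

omit [Fintype S] [Fintype ι] [LinearOrder κ] [Fintype P] in
/-- A pristine observable has weight one (bookkeeping). [folklore] -/
private theorem wt_pristine (B : P → ℝ) (cV : ι → ℝ) (j : κ) : wt B cV (pristine (ι := ι) (P := P) obs j) = 1 := by
  simp [wt, pristine]

/-- **THE WEIGHT OF A TERM, COMPONENT BY COMPONENT** (p. 312): under the hypotheses of `run_weight`, for every term `t`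
of `expand done rest` (set-aside components with legs in `Dir`):
`|coef_t| · Π_{z ∈ dirs_t}‖z‖ · Π_{h ∈ done} wt h ≤ Π_{X ∈ t.consts} wt X · Π_{X ∈ t.groups} wt X` — every large bracket
factor, every small random-walk factor and every coupling is booked in the block or remainder component where it
occurred. [cite: BalabanImbrieJaffe1988, §5.14 p.312] -/
theorem expand_weight {Dir : Set (S → ℝ)} {B : P → ℝ} {cV : ι → ℝ} (hB0 : ∀ p, 0 ≤ B p) (hcV0 : ∀ m, 0 ≤ cV m)
    (hB : ∀ p, ∀ u ∈ Dir, ∀ w ∈ Dir, |(Cov p *ᵥ u) ⬝ᵥ w| ≤ B p) (hBf : ∀ p, ∀ u ∈ Dir, |(Cov p *ᵥ u) ⬝ᵥ f| ≤ B p)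
    (hBz : ∀ p, ∀ u ∈ Dir, ‖Cov p *ᵥ u‖ ≤ B p) (hcV : ∀ m, |c m| ≤ cV m)
    (hobs : ∀ j, ∀ w ∈ obs j, w ∈ Dir) (hlegs : ∀ m, ∀ w ∈ legs m, w ∈ Dir) :
    ∀ (n : ℕ) (done : Multiset (WGrp S κ ι P)) (rest : Finset κ), rest.card < n →
      (∀ h ∈ done, ∀ w ∈ h.pend, w ∈ Dir) → ∀ t ∈ expand Cov trig f c legs obs M done rest,
        |t.coef| * (t.dirs.map fun z => ‖z‖).prod * (done.map (wt B cV)).prod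
          ≤ (t.consts.map (wt B cV)).prod * (t.groups.map (wt B cV)).prod
  | 0, _, _, hn => fun _ _ _ => absurd hn (Nat.not_lt_zero _)
  | n + 1, done, rest, hn => by
    intro hd t ht
    by_cases h : rest.Nonempty
    · rw [expand_of_nonempty Cov trig f c legs obs M h, mem_mbind] at ht
      obtain ⟨o, ho, ht⟩ := ht
      have hcard : o.rest.card < n := lt_of_lt_of_le (lt_of_le_of_lt (Finset.card_le_card (run_rest_subset _ _ _ o ho))
        (Finset.card_erase_lt_of_mem (rest.min'_mem h))) (Nat.lt_succ_iff.1 hn)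
      -- the run of the pristine observable: `tsize o · Π_done wt ≤ wt o.g · Π_{o.done} wt`
      have hrun := run_weight (trig := trig) (M := M) hB0 hcV0 hB hBf hBz hcV hobs hlegs (pristine obs (rest.min' h))
        (rest.erase (rest.min' h)) done o ho (hobs _) hd
      rw [wt_pristine, one_mul] at hrun
      -- legs of the set-aside components of the outcome are in `Dir`
      have hdo : ∀ h' ∈ o.done, ∀ w ∈ h'.pend, w ∈ Dir :=
        fun h' hh' => hd h' (Multiset.mem_of_le (run_done_le _ _ _ o ho) hh')
      split_ifs at ht with hg
      · rw [Multiset.mem_map] at ht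
        obtain ⟨t', ht', rfl⟩ := ht
        have IH := expand_weight hB0 hcV0 hB hBf hBz hcV hobs hlegs n o.done o.rest hcard hdo t' ht'
        simp only [WTerm.addConst_coef, WTerm.addConst_dirs, WTerm.addConst_consts, WTerm.addConst_groups, oact_coef,
          oact_dirs, oact_consts, oact_groups, abs_mul, List.map_append, List.prod_append, Multiset.map_cons,
          Multiset.prod_cons]
        have hT := tsize_nonneg o
        have h1 : 0 ≤ |t'.coef| * (t'.dirs.map fun z => ‖z‖).prod :=
          mul_nonneg (abs_nonneg _) (List.prod_nonneg fun x hx => by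
            obtain ⟨z, -, rfl⟩ := List.mem_map.1 hx; exact norm_nonneg _)
        calc |o.a| * |t'.coef| * (((o.D.map fun z => ‖z‖).prod) * (t'.dirs.map fun z => ‖z‖).prod)
              * (done.map (wt B cV)).prod
            = (|t'.coef| * (t'.dirs.map fun z => ‖z‖).prod) * (tsize o * (done.map (wt B cV)).prod) := by
              simp only [tsize]; ring
          _ ≤ (|t'.coef| * (t'.dirs.map fun z => ‖z‖).prod) * (wt B cV o.g * (o.done.map (wt B cV)).prod) :=
              mul_le_mul_of_nonneg_left hrun h1
          _ = wt B cV o.g * (|t'.coef| * (t'.dirs.map fun z => ‖z‖).prod * (o.done.map (wt B cV)).prod) := by ring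
          _ ≤ wt B cV o.g * ((t'.consts.map (wt B cV)).prod * (t'.groups.map (wt B cV)).prod) :=
              mul_le_mul_of_nonneg_left IH (wt_nonneg hB0 hcV0 _)
          _ = wt B cV o.g * (t'.consts.map (wt B cV)).prod * (t'.groups.map (wt B cV)).prod := by ring
      · rw [Multiset.mem_map] at ht
        obtain ⟨t', ht', rfl⟩ := ht
        have hdo' : ∀ h' ∈ o.g ::ₘ o.done, ∀ w ∈ h'.pend, w ∈ Dir := fun h' hh' => by
          rcases Multiset.mem_cons.1 hh' with rfl | hh'
          · -- legs of the outcome's component: from the direction bookkeeping of the run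
            intro w hw
            exact run_pend_dir (trig := trig) (M := M) hobs hlegs _ _ _ o ho (hobs _) hd w hw
          · exact hdo h' hh'
        have IH := expand_weight hB0 hcV0 hB hBf hBz hcV hobs hlegs n _ o.rest hcard hdo' t' ht'
        simp only [oact_coef, oact_dirs, oact_consts, oact_groups, abs_mul, List.map_append, List.prod_append,
          Multiset.map_cons, Multiset.prod_cons] at IH ⊢
        have h1 : 0 ≤ |t'.coef| * (t'.dirs.map fun z => ‖z‖).prod :=
          mul_nonneg (abs_nonneg _) (List.prod_nonneg fun x hx => by
            obtain ⟨z, -, rfl⟩ := List.mem_map.1 hx; exact norm_nonneg _)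
        calc |o.a| * |t'.coef| * (((o.D.map fun z => ‖z‖).prod) * (t'.dirs.map fun z => ‖z‖).prod)
              * (done.map (wt B cV)).prod
            = (|t'.coef| * (t'.dirs.map fun z => ‖z‖).prod) * (tsize o * (done.map (wt B cV)).prod) := by
              simp only [tsize]; ring
          _ ≤ (|t'.coef| * (t'.dirs.map fun z => ‖z‖).prod) * (wt B cV o.g * (o.done.map (wt B cV)).prod) :=
              mul_le_mul_of_nonneg_left hrun h1
          _ = |t'.coef| * (t'.dirs.map fun z => ‖z‖).prod * (wt B cV o.g * (o.done.map (wt B cV)).prod) := rfl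
          _ ≤ (t'.consts.map (wt B cV)).prod * (t'.groups.map (wt B cV)).prod := IH
    · rw [expand_of_not_nonempty Cov trig f c legs obs M h, Multiset.mem_singleton] at ht
      subst ht
      simp

/-- **Corollary** (from nothing set aside): for the integration by parts of a product of observables,
`|coef_t| · Π_{z ∈ dirs_t}‖z‖ ≤ Π_{X ∈ t.consts} wt X · Π_{X ∈ t.groups} wt X` for every term `t` of `expand 0 K`.
[cite: BalabanImbrieJaffe1988, §5.14 p.312] -/
theorem expand_weight_init {Dir : Set (S → ℝ)} {B : P → ℝ} {cV : ι → ℝ} (hB0 : ∀ p, 0 ≤ B p) (hcV0 : ∀ m, 0 ≤ cV m)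
    (hB : ∀ p, ∀ u ∈ Dir, ∀ w ∈ Dir, |(Cov p *ᵥ u) ⬝ᵥ w| ≤ B p) (hBf : ∀ p, ∀ u ∈ Dir, |(Cov p *ᵥ u) ⬝ᵥ f| ≤ B p)
    (hBz : ∀ p, ∀ u ∈ Dir, ‖Cov p *ᵥ u‖ ≤ B p) (hcV : ∀ m, |c m| ≤ cV m)
    (hobs : ∀ j, ∀ w ∈ obs j, w ∈ Dir) (hlegs : ∀ m, ∀ w ∈ legs m, w ∈ Dir) (K : Finset κ) :
    ∀ t ∈ expand Cov trig f c legs obs M 0 K,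
      |t.coef| * (t.dirs.map fun z => ‖z‖).prod ≤ (t.consts.map (wt B cV)).prod * (t.groups.map (wt B cV)).prod := by
  intro t ht
  have h := expand_weight (trig := trig) (M := M) hB0 hcV0 hB hBf hBz hcV hobs hlegs _ 0 K (Nat.lt_succ_self _)
    (fun _ hh => absurd hh (Multiset.notMem_zero _)) t ht
  simpa using h

end Expand

end Literature.MathematicalPhysics.QuantumFieldTheory.BalabanImbrieJaffe1984to88.BIJ88WalkWeights312

end
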